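import Literature.NumberTheory.LFunctions.WeilFinitePrimeQuadratic
import Literature.NumberTheory.LFunctions.WeilFirstPrimePositivityC
import Mathlib.Tactic.NormNum.Prime
import HarnessLib

/-!
# The semi-local Weil quadratic form at a finite set of primes `S ∪ {∞}`

Topic: `Literature/NumberTheory/LFunctions`.  Connes' semi-local framework keeps the archimedean place and a
FINITE set `S` of primes and drops every other prime from Weil's explicit-formula functional
(`Connes1999`, §VII Thm 4: the `S`-local Weil sum `Σ_{v ∈ S} ∫'_{k_v^*} h(u⁻¹)/|1−u| d^*u`; for `k = ℚ` and a
prime `v = p` that term is `Σ_{m ≥ 1} (log p) p^{-m/2}(k(m log p) + k(−m log p))` in the normalisation of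
`WeilExplicit`).  In the tree's normalisation (`weilFunctional = polar − prime + arch`) the semi-local functional is

`W_S(k) = k̂(0) + k̂(1) − Σ_{n : primeFactors n ⊆ S} Λ(n) n^{-1/2} (k(log n) + k(−log n)) + W_∞(k)`,

its quadratic form is `Q_S(g) = W_S(g ⋆ g̃)` and **semi-local Weil positivity on the cone `C(a)`** is
`WeilSemilocalPositivityOn S a : ∀ g ∈ C_c^∞[−a, a], 0 ≤ Re Q_S(g)`.
(`ConnesConsani2023` §2.1.2 writes the same functional `ψ(F) = F̂(i/2) + F̂(−i/2) − W_ℝ(F) − Σ_p W_p(F)` with all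
primes and restricts the SUPPORT instead; on `C((log q)/2)`, `q` the least prime power whose prime is not in `S`,
the two notions coincide — `weilSemilocalQuadratic_eq_weilQuadratic_of_forall`.)

Everything is PROVED (no named facts):

* `weilSemilocalQuadratic_eq_weilSemilocalAnalytic` — on every window `C((log (N+1))/2)` the form has Yoshida's
  analytic shape `E_{S,N}(g) = 2 Re(ĝ(0) conj ĝ(1)) − (log π)‖g‖₂² + (1/2π)∫|ĝ(1/2+it)|² w_{S,N}(t) dt` with the
  `S`-smooth ripple `w_{S,N} = Re ψ(1/4+it/2) − Σ_{n ≤ N, primeFactors n ⊆ S} (Λ(n)/√n) 2cos(t log n)`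
  (copy of `weilQuadratic_eq_weilFinitePrimeQuadratic` with the `S`-smooth coefficient);
* `S = {2}` (the places `{∞, 2}`): on `C(log 2)` the form IS the first-prime form `E₂` of
  `WeilFirstPrimeQuadratic` (`re_weilSemilocalQuadratic_two_eq_weilFirstPrimeQuadratic`), and on `C(log 3)` it is
  the dyadic form `E_{2,4,8}` with weight `w₂(t) − log 2·cos(t log 4) − (log 2/√2) cos(t log 8)`
  (`re_weilSemilocalQuadratic_two_eq_weilDyadicQuadratic`);
* `weilSemilocalPositivityOn_two_certb` — **`{∞,2}`-positivity holds on `C(563/1024)`** (`563/1024 > (log 3)/2`: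
  a window on which the FULL form already sees the prime `3`), from the kernel-checked certificate `weilCert3C`;
* `weilSemilocalPositivityOn_two_log_three_half` — and on `C((log 3)/2)`, where it coincides with `WeilPositivityOn`.

Numerically (two engines, pub-weilobs `primedel{3}` arb/mpb and pub-rhdoor engine C) the `{∞,2}` form stops being
positive at `a* ≈ 0.5578` (odd sector), far below `log 2`; so no positivity theorem is claimed beyond the sliver.

## References

* A. Connes, *Trace formula in noncommutative geometry and the zeros of the Riemann zeta function*, Selecta
  Math. 5 (1999) 29–106, §VII Theorem 4 (semi-local trace formula; the `S`-local Weil sum). [Connes1999]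
* A. Connes, C. Consani, *Spectral triples and ζ-cycles*, Enseign. Math. 69 (2023), §2.1.2 (the functional `ψ`,
  semi-local Weil quadratic form `QW_λ`). [ConnesConsani2023]
* H. Yoshida, *On Hermitian forms attached to zeta functions*, Adv. Stud. Pure Math. 21 (1992), §2 eq. (2.1).
  [Yoshida1992]
-/

noncomputable section

open Complex Filter Set MeasureTheory
open scoped Real Topology ComplexConjugate

namespace Literature.NumberTheory.LFunctions

variable {g : ℝ → ℂ}

/-! ## The semi-local functional, quadratic form and positivity -/

/-- The `S`-smooth explicit-formula coefficient `Λ_S(n)/√n`: `Λ(n)/√n` if every prime factor of `n` lies in `S`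
(for a prime power `n = p^m`: iff `p ∈ S`), else `0`. [cite: Connes1999, §VII Thm 4 (the S-local Weil sum, v = p ∈ S)] -/
def weilSemilocalCoeff (S : Finset ℕ) (n : ℕ) : ℝ :=
  if n.primeFactors ⊆ S then (ArithmeticFunction.vonMangoldt n : ℝ) / Real.sqrt n else 0

/-- The semi-local prime term `Σ_{n : primeFactors n ⊆ S} Λ(n) n^{-1/2} (k(log n) + k(−log n))`: the finite places
`p ∈ S` of Connes' `S`-local Weil sum. [cite: Connes1999, §VII Thm 4 (the S-local Weil sum, v = p ∈ S)] -/
def weilSemilocalPrimeTerm (S : Finset ℕ) (k : ℝ → ℂ) : ℂ :=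
  ∑' n : ℕ, (weilSemilocalCoeff S n : ℂ) * (k (Real.log n) + k (-Real.log n))

/-- The semi-local Weil functional at the places `S ∪ {∞}`: `W_S(k) = k̂(0) + k̂(1) − (primes in S) + W_∞(k)`.
[cite: Connes1999, §VII Thm 4 (semi-local Weil sum over v ∈ S ∪ {∞}); ConnesConsani2023 §2.1.2 (ψ)] -/
def weilSemilocalFunctional (S : Finset ℕ) (k : ℝ → ℂ) : ℂ :=
  weilPolarTerm k - weilSemilocalPrimeTerm S k + weilArchTerm k

/-- The semi-local Weil quadratic form `Q_S(g) = W_S(g ⋆ g̃)`. [cite: ConnesConsani2023, §2.1.2 (QW(f,g) = ψ(f^* * g)) with the primes restricted to S] -/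
def weilSemilocalQuadratic (S : Finset ℕ) (g : ℝ → ℂ) : ℂ :=
  weilSemilocalFunctional S (weilConv g (weilReflect g))

/-- **Semi-local Weil positivity on the cone `C(a)`** at the places `S ∪ {∞}`:
`Re Q_S(g) ≥ 0` for every Weil test function with `tsupport g ⊆ [−a, a]`. [cite: ConnesConsani2023, §2.1.2 (positivity of QW_λ) with the primes restricted to S] -/
def WeilSemilocalPositivityOn (S : Finset ℕ) (a : ℝ) : Prop :=
  ∀ g : ℝ → ℂ, IsWeilTest g → tsupport g ⊆ Icc (-a) a → 0 ≤ (weilSemilocalQuadratic S g).re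

/-- Positivity on a cone is inherited by smaller cones. [folklore] -/
theorem WeilSemilocalPositivityOn.mono {S : Finset ℕ} {a b : ℝ} (h : WeilSemilocalPositivityOn S b)
    (hab : a ≤ b) : WeilSemilocalPositivityOn S a :=
  fun g hg hsupp ↦ h g hg (hsupp.trans (Icc_subset_Icc (neg_le_neg hab) hab))

/-! ## The analytic form on the window `C((log (N+1))/2)` -/

/-- The `S`-smooth truncated prime ripple `ρ_{S,N}(t) = Σ_{n ≤ N} (Λ_S(n)/√n) · 2cos(t log n)`. [cite: Yoshida1992, §2 eq. (2.1), the p^m-terms with p ∈ S, p^m ≤ N] -/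
def weilSemilocalRipple (S : Finset ℕ) (N : ℕ) (t : ℝ) : ℝ :=
  ∑ n ∈ Finset.range (N + 1), weilSemilocalCoeff S n * (2 * Real.cos (t * Real.log n))

/-- The semi-local weight `w_{S,N}(t) = Re ψ(1/4 + it/2) − ρ_{S,N}(t)`. [cite: Yoshida1992, §2 eq. (2.1), the p^m-terms with p ∈ S, p^m ≤ N] -/
def weilSemilocalWeight (S : Finset ℕ) (N : ℕ) (t : ℝ) : ℝ :=
  Literature.Analysis.SpecialFunctions.reDigammaQuarter t - weilSemilocalRipple S N t

/-- The semi-local analytic form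
`E_{S,N}(g) = 2 Re(ĝ(0) conj ĝ(1)) − (log π) ‖g‖₂² + (1/2π) ∫ |ĝ(1/2+it)|² w_{S,N}(t) dt`. [cite: Yoshida1992, §2 eq. (2.1), the p^m-terms with p ∈ S, p^m ≤ N] -/
def weilSemilocalAnalytic (S : Finset ℕ) (N : ℕ) (g : ℝ → ℂ) : ℝ :=
  2 * (weilMellin g 0 * conj (weilMellin g 1)).re - Real.log π * weilNorm2Sq g +
    1 / (2 * π) * ∫ t : ℝ, ‖weilMellin g (1 / 2 + t * I)‖ ^ 2 * weilSemilocalWeight S N t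

/-- The ripple is continuous. [folklore] -/
theorem continuous_weilSemilocalRipple (S : Finset ℕ) (N : ℕ) : Continuous (weilSemilocalRipple S N) := by
  unfold weilSemilocalRipple
  fun_prop

/-- The weight is measurable. [folklore] -/
theorem measurable_weilSemilocalWeight (S : Finset ℕ) (N : ℕ) : Measurable (weilSemilocalWeight S N) :=
  Literature.Analysis.SpecialFunctions.measurable_reDigammaQuarter.sub
    (continuous_weilSemilocalRipple S N).measurable

/-- `∫ |ĝ|² ρ_{S,N}` converges and equals the finite sum of the spike integrals
`Σ_{n ≤ N} (Λ_S(n)/√n) ∫ |ĝ(1/2+it)|² 2cos(t log n) dt`. [folklore] -/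
theorem integral_norm_sq_weilMellin_mul_weilSemilocalRipple (hg : IsWeilTest g) (S : Finset ℕ) (N : ℕ) :
    Integrable (fun t : ℝ ↦ ‖weilMellin g (1 / 2 + t * I)‖ ^ 2 * weilSemilocalRipple S N t) ∧
      ∫ t : ℝ, ‖weilMellin g (1 / 2 + t * I)‖ ^ 2 * weilSemilocalRipple S N t =
        ∑ n ∈ Finset.range (N + 1), weilSemilocalCoeff S n *
          ∫ t : ℝ, ‖weilMellin g (1 / 2 + t * I)‖ ^ 2 * (2 * Real.cos (t * Real.log n)) := by
  have e : (fun t : ℝ ↦ ‖weilMellin g (1 / 2 + t * I)‖ ^ 2 * weilSemilocalRipple S N t) =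
      fun t : ℝ ↦ ∑ n ∈ Finset.range (N + 1), weilSemilocalCoeff S n *
        (‖weilMellin g (1 / 2 + t * I)‖ ^ 2 * (2 * Real.cos (t * Real.log n))) := by
    funext t
    unfold weilSemilocalRipple
    rw [Finset.mul_sum]
    exact Finset.sum_congr rfl fun n _ ↦ by ring
  have hI : ∀ n ∈ Finset.range (N + 1), Integrable fun t : ℝ ↦
      weilSemilocalCoeff S n * (‖weilMellin g (1 / 2 + t * I)‖ ^ 2 * (2 * Real.cos (t * Real.log n))) :=
    fun n _ ↦ (integrable_norm_sq_weilMellin_mul_two_cos hg (Real.log n)).const_mul _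
  rw [e]
  refine ⟨integrable_finsetSum _ hI, ?_⟩
  rw [integral_finsetSum _ hI]
  exact Finset.sum_congr rfl fun n _ ↦ integral_const_mul _ _

/-- `t ↦ |ĝ(1/2+it)|² w_{S,N}(t)` is integrable. [folklore] -/
theorem integrable_norm_sq_weilMellin_mul_weilSemilocalWeight (hg : IsWeilTest g) (S : Finset ℕ) (N : ℕ) :
    Integrable fun t : ℝ ↦ ‖weilMellin g (1 / 2 + t * I)‖ ^ 2 * weilSemilocalWeight S N t := by
  have h1 := integrable_norm_sq_weilMellin_mul_reDigammaQuarter hg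
  have h2 := (integral_norm_sq_weilMellin_mul_weilSemilocalRipple hg S N).1
  have e : (fun t : ℝ ↦ ‖weilMellin g (1 / 2 + t * I)‖ ^ 2 * weilSemilocalWeight S N t) =
      fun t : ℝ ↦ ‖weilMellin g (1 / 2 + t * I)‖ ^ 2 *
          Literature.Analysis.SpecialFunctions.reDigammaQuarter t -
        ‖weilMellin g (1 / 2 + t * I)‖ ^ 2 * weilSemilocalRipple S N t := by
    funext t; unfold weilSemilocalWeight; ring
  rw [e]
  exact h1.sub h2

/-- Only the `S`-smooth prime powers `n ≤ N` enter on the window `[-log (N+1), log (N+1)]`: for a continuous `k`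
with `tsupport k ⊆ [-log (N+1), log (N+1)]` the semi-local prime term is the FINITE sum
`Σ_{n ≤ N} (Λ_S(n)/√n)(k(log n) + k(−log n))`. [cite: Connes1999, §VII Thm 4 (S-local sum) restricted to supp ⊆ [−log (N+1), log (N+1)]] -/
theorem weilSemilocalPrimeTerm_eq_sum_of_tsupport_subset (S : Finset ℕ) {k : ℝ → ℂ} (hk : Continuous k) (N : ℕ)
    (hsupp : tsupport k ⊆ Icc (-Real.log ((N : ℝ) + 1)) (Real.log ((N : ℝ) + 1))) :
    weilSemilocalPrimeTerm S k =
      ∑ n ∈ Finset.range (N + 1), (weilSemilocalCoeff S n : ℂ) * (k (Real.log n) + k (-Real.log n)) := by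
  have hIoo : Function.support k ⊆ Ioo (-Real.log ((N : ℝ) + 1)) (Real.log ((N : ℝ) + 1)) :=
    support_subset_Ioo_of_tsupport_subset_Icc hk hsupp
  have hzero : ∀ x : ℝ, Real.log ((N : ℝ) + 1) ≤ |x| → k x = 0 := by
    intro x hx
    by_contra hne
    have hmem := hIoo (Function.mem_support.2 hne)
    rw [mem_Ioo] at hmem
    have : |x| < Real.log ((N : ℝ) + 1) := abs_lt.2 ⟨hmem.1, hmem.2⟩
    linarith
  have hfin : ∀ n ∉ Finset.range (N + 1),
      (weilSemilocalCoeff S n : ℂ) * (k (Real.log n) + k (-Real.log n)) = 0 := by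
    intro n hn
    rw [Finset.mem_range, not_lt] at hn
    have hn' : (N : ℝ) + 1 ≤ n := by exact_mod_cast hn
    have hlog : Real.log ((N : ℝ) + 1) ≤ Real.log n := Real.log_le_log (by positivity) hn'
    have hpos : 0 ≤ Real.log n := (Real.log_nonneg (by linarith)).trans hlog
    rw [hzero _ (by rwa [abs_of_nonneg hpos]), hzero _ (by rwa [abs_neg, abs_of_nonneg hpos])]
    simp
  unfold weilSemilocalPrimeTerm
  exact tsum_eq_sum hfin

/-- **`Q_S(g)` in analytic form on `C((log (N+1))/2)`**: for `tsupport g ⊆ [-(log (N+1))/2, (log (N+1))/2]`,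
`W_S(g ⋆ g̃) = E_{S,N}(g)` as a complex number. [cite: Yoshida1992, §2 eq. (2.1), the p^m-terms with p ∈ S, p^m ≤ N; Connes1999 §VII Thm 4] -/
theorem weilSemilocalQuadratic_eq_weilSemilocalAnalytic (hg : IsWeilTest g) (S : Finset ℕ) (N : ℕ)
    (hsupp : tsupport g ⊆ Icc (-(Real.log ((N : ℝ) + 1) / 2)) (Real.log ((N : ℝ) + 1) / 2)) :
    weilSemilocalQuadratic S g = (weilSemilocalAnalytic S N g : ℂ) := by
  have hk : IsWeilTest (weilConv g (weilReflect g)) := hg.weilConv hg.weilReflect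
  have hks : tsupport (weilConv g (weilReflect g)) ⊆
      Icc (-Real.log ((N : ℝ) + 1)) (Real.log ((N : ℝ) + 1)) := by
    have h := tsupport_weilConv_weilReflect_subset (a := Real.log ((N : ℝ) + 1) / 2) hg.2 hsupp
    rwa [show 2 * (Real.log ((N : ℝ) + 1) / 2) = Real.log ((N : ℝ) + 1) by ring] at h
  set T : ℂ := ∑ n ∈ Finset.range (N + 1), (weilSemilocalCoeff S n : ℂ) *
      ((∫ t : ℝ, ‖weilMellin g (1 / 2 + t * I)‖ ^ 2 * (2 * Real.cos (t * Real.log n)) : ℝ) : ℂ)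
    with hT
  have hprime : weilSemilocalPrimeTerm S (weilConv g (weilReflect g)) = (1 / (2 * π) : ℂ) * T := by
    rw [weilSemilocalPrimeTerm_eq_sum_of_tsupport_subset S hk.1.continuous N hks, hT, Finset.mul_sum]
    refine Finset.sum_congr rfl fun n _ ↦ ?_
    rw [weilConv_weilReflect_add_eq_integral hg (Real.log n)]
    ring
  have hrip : (((∫ t : ℝ, ‖weilMellin g (1 / 2 + t * I)‖ ^ 2 * weilSemilocalRipple S N t) : ℝ) : ℂ) = T := by
    rw [(integral_norm_sq_weilMellin_mul_weilSemilocalRipple hg S N).2, hT]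
    push_cast
    rfl
  have hsplit : ∫ t : ℝ, ‖weilMellin g (1 / 2 + t * I)‖ ^ 2 * weilSemilocalWeight S N t =
      (∫ t : ℝ, ‖weilMellin g (1 / 2 + t * I)‖ ^ 2 *
          Literature.Analysis.SpecialFunctions.reDigammaQuarter t) -
        ∫ t : ℝ, ‖weilMellin g (1 / 2 + t * I)‖ ^ 2 * weilSemilocalRipple S N t := by
    have e : (fun t : ℝ ↦ ‖weilMellin g (1 / 2 + t * I)‖ ^ 2 * weilSemilocalWeight S N t) =
        fun t : ℝ ↦ ‖weilMellin g (1 / 2 + t * I)‖ ^ 2 *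
            Literature.Analysis.SpecialFunctions.reDigammaQuarter t -
          ‖weilMellin g (1 / 2 + t * I)‖ ^ 2 * weilSemilocalRipple S N t := by
      funext t; unfold weilSemilocalWeight; ring
    rw [e, integral_sub (integrable_norm_sq_weilMellin_mul_reDigammaQuarter hg)
      (integral_norm_sq_weilMellin_mul_weilSemilocalRipple hg S N).1]
  unfold weilSemilocalQuadratic weilSemilocalFunctional weilArchTerm weilSemilocalAnalytic
  rw [hprime, weilPolarTerm_weilConv_weilReflect hg, weilArchIntegral_weilConv_weilReflect hg,
    weilConv_weilReflect_apply_zero, hsplit]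
  unfold weilNorm2Sq Literature.Analysis.SpecialFunctions.reDigammaQuarter
  push_cast
  rw [hrip]
  ring

/-- Real-part version: `Re Q_S(g) = E_{S,N}(g)` on `C((log (N+1))/2)`. [cite: Yoshida1992, §2 eq. (2.1), the p^m-terms with p ∈ S, p^m ≤ N] -/
theorem re_weilSemilocalQuadratic_eq_weilSemilocalAnalytic (hg : IsWeilTest g) (S : Finset ℕ) (N : ℕ)
    (hsupp : tsupport g ⊆ Icc (-(Real.log ((N : ℝ) + 1) / 2)) (Real.log ((N : ℝ) + 1) / 2)) :
    (weilSemilocalQuadratic S g).re = weilSemilocalAnalytic S N g := by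
  rw [weilSemilocalQuadratic_eq_weilSemilocalAnalytic hg S N hsupp, Complex.ofReal_re]

/-- On `C((log (N+1))/2)` the semi-local quadratic form is real. [folklore] -/
theorem im_weilSemilocalQuadratic_eq_zero (hg : IsWeilTest g) (S : Finset ℕ) (N : ℕ)
    (hsupp : tsupport g ⊆ Icc (-(Real.log ((N : ℝ) + 1) / 2)) (Real.log ((N : ℝ) + 1) / 2)) :
    (weilSemilocalQuadratic S g).im = 0 := by
  rw [weilSemilocalQuadratic_eq_weilSemilocalAnalytic hg S N hsupp, Complex.ofReal_im]

/-- **Reduction of semi-local positivity on `C(a)`, `a ≤ (log (N+1))/2`, to the analytic form `E_{S,N}`.** [cite: Yoshida1992, Thm 1 shape (§6) with the p^m-terms, p ∈ S, p^m ≤ N] -/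
theorem weilSemilocalPositivityOn_iff_analytic (S : Finset ℕ) (N : ℕ) {a : ℝ}
    (ha : a ≤ Real.log ((N : ℝ) + 1) / 2) :
    WeilSemilocalPositivityOn S a ↔
      ∀ g : ℝ → ℂ, IsWeilTest g → tsupport g ⊆ Icc (-a) a → 0 ≤ weilSemilocalAnalytic S N g := by
  unfold WeilSemilocalPositivityOn
  refine forall₃_congr fun g hg hsupp ↦ ?_
  rw [re_weilSemilocalQuadratic_eq_weilSemilocalAnalytic hg S N
    (hsupp.trans (Icc_subset_Icc (neg_le_neg ha) ha))]

/-! ## Coincidence with the full form below the first missing prime -/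

/-- If every prime power `n ≤ N` is `S`-smooth (no prime outside `S` is visible on the window), the semi-local
coefficient is the full one for all `n ≤ N`. [folklore] -/
theorem weilSemilocalCoeff_eq_of_forall {S : Finset ℕ} {N : ℕ}
    (hS : ∀ n ≤ N, IsPrimePow n → n.primeFactors ⊆ S) {n : ℕ} (hn : n ≤ N) :
    weilSemilocalCoeff S n = (ArithmeticFunction.vonMangoldt n : ℝ) / Real.sqrt n := by
  unfold weilSemilocalCoeff
  by_cases hp : IsPrimePow n
  · rw [if_pos (hS n hn hp)]
  · rw [ArithmeticFunction.vonMangoldt_eq_zero_iff.2 hp]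
    simp

/-- **Below the first missing prime the semi-local form IS Weil's form**: if every prime power `n ≤ N` has its
prime in `S`, then `Q_S(g) = Q(g)` on `C((log (N+1))/2)`. [cite: ConnesConsani2023, §2.1.2 (only the primes p < λ² enter QW_λ)] -/
theorem weilSemilocalQuadratic_eq_weilQuadratic_of_forall (hg : IsWeilTest g) {S : Finset ℕ} {N : ℕ}
    (hS : ∀ n ≤ N, IsPrimePow n → n.primeFactors ⊆ S)
    (hsupp : tsupport g ⊆ Icc (-(Real.log ((N : ℝ) + 1) / 2)) (Real.log ((N : ℝ) + 1) / 2)) :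
    weilSemilocalQuadratic S g = weilQuadratic g := by
  rw [weilSemilocalQuadratic_eq_weilSemilocalAnalytic hg S N hsupp, weilQuadratic_eq_weilFinitePrimeQuadratic hg N hsupp]
  congr 1
  unfold weilSemilocalAnalytic weilFinitePrimeQuadratic weilSemilocalWeight weilFinitePrimeWeight
    weilSemilocalRipple weilPrimeRipple
  congr 3
  funext t
  congr 2
  exact Finset.sum_congr rfl fun n hn ↦ by
    rw [weilSemilocalCoeff_eq_of_forall hS (Nat.lt_succ_iff.1 (Finset.mem_range.1 hn))]

/-- Hence semi-local and full positivity agree on such a window. [folklore] -/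
theorem weilSemilocalPositivityOn_iff_weilPositivityOn_of_forall {S : Finset ℕ} {N : ℕ}
    (hS : ∀ n ≤ N, IsPrimePow n → n.primeFactors ⊆ S) :
    WeilSemilocalPositivityOn S (Real.log ((N : ℝ) + 1) / 2) ↔ WeilPositivityOn (Real.log ((N : ℝ) + 1) / 2) := by
  unfold WeilSemilocalPositivityOn WeilPositivityOn
  refine forall₃_congr fun g hg hsupp ↦ ?_
  rw [weilSemilocalQuadratic_eq_weilQuadratic_of_forall hg hS hsupp]

/-! ## `S = {2}`: the places `{∞, 2}` -/

/-- `Λ_{{2}}(0) = 0`. [folklore] -/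
theorem weilSemilocalCoeff_two_zero : weilSemilocalCoeff {2} 0 = 0 := by
  simp [weilSemilocalCoeff]

/-- `Λ_{{2}}(1) = 0`. [folklore] -/
theorem weilSemilocalCoeff_two_one : weilSemilocalCoeff {2} 1 = 0 := by
  simp [weilSemilocalCoeff]

/-- `Λ_{{2}}(2^m)/√(2^m) = log 2/√(2^m)` for `m ≥ 1`. [folklore] -/
theorem weilSemilocalCoeff_two_pow {m : ℕ} (hm : m ≠ 0) :
    weilSemilocalCoeff {2} (2 ^ m) = Real.log 2 / Real.sqrt (2 ^ m : ℕ) := by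
  unfold weilSemilocalCoeff
  rw [Nat.primeFactors_prime_pow hm Nat.prime_two, if_pos (Finset.Subset.refl _),
    ArithmeticFunction.vonMangoldt_apply_pow hm, ArithmeticFunction.vonMangoldt_apply_prime Nat.prime_two]
  push_cast
  rfl

/-- An odd prime is invisible at `S = {2}`: `Λ_{{2}}(p) = 0` for a prime `p ≠ 2`. [folklore] -/
theorem weilSemilocalCoeff_two_prime {p : ℕ} (hp : p.Prime) (h2 : p ≠ 2) : weilSemilocalCoeff {2} p = 0 := by
  unfold weilSemilocalCoeff
  rw [hp.primeFactors, if_neg]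
  simpa using h2

/-- A non-prime-power contributes nothing. [folklore] -/
theorem weilSemilocalCoeff_of_not_isPrimePow (S : Finset ℕ) {n : ℕ} (hn : ¬ IsPrimePow n) :
    weilSemilocalCoeff S n = 0 := by
  unfold weilSemilocalCoeff
  rw [ArithmeticFunction.vonMangoldt_eq_zero_iff.2 hn]
  simp

/-- **On `C(log 2)` the `{∞,2}`-weight is the first-prime weight**: `w_{{2},3} = w₂ = Re ψ(1/4+it/2) − √2 log 2 cos(t log 2)`
(only `n = 2` is a visible power of `2` below `4`). [cite: Yoshida1992, §2 eq. (2.1) with the p = 2 term] -/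
theorem weilSemilocalWeight_two_three (t : ℝ) : weilSemilocalWeight {2} 3 t = weilFirstPrimeWeight t := by
  unfold weilSemilocalWeight weilSemilocalRipple weilFirstPrimeWeight
  simp only [Finset.sum_range_succ, Finset.sum_range_zero, weilSemilocalCoeff_two_zero,
    weilSemilocalCoeff_two_one, weilSemilocalCoeff_two_prime Nat.prime_three (by norm_num)]
  have h2 : weilSemilocalCoeff {2} 2 = Real.log 2 / Real.sqrt 2 := by
    have h := weilSemilocalCoeff_two_pow one_ne_zero
    simpa using h
  rw [h2, show ((2 : ℕ) : ℝ) = 2 by norm_num, log_div_sqrt_eq two_pos]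
  have hs : Real.sqrt 2 * Real.sqrt 2 = 2 := Real.mul_self_sqrt (by norm_num)
  have e : Real.sqrt 2 * Real.log 2 / 2 * (2 * Real.cos (t * Real.log 2)) =
      Real.sqrt 2 * Real.log 2 * Real.cos (t * Real.log 2) := by ring
  rw [e]
  ring

/-- **`E_{{2},3} = E₂`**: on its `log 2`-window the `{∞,2}` analytic form is the first-prime form of
`WeilFirstPrimeQuadratic` (for every `g`). [cite: Yoshida1992, §2 eq. (2.1) with the p = 2 term] -/
theorem weilSemilocalAnalytic_two_three (g : ℝ → ℂ) : weilSemilocalAnalytic {2} 3 g = weilFirstPrimeQuadratic g := by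
  unfold weilSemilocalAnalytic weilFirstPrimeQuadratic
  simp_rw [weilSemilocalWeight_two_three]

/-- `log 4 / 2 = log 2`. [folklore] -/
theorem log_four_half : Real.log ((3 : ℕ) + 1 : ℝ) / 2 = Real.log 2 := by
  rw [show ((3 : ℕ) : ℝ) + 1 = 2 ^ 2 by norm_num, Real.log_pow]
  push_cast
  ring

/-- **The `{∞,2}` semi-local form on `C(log 2)` is `E₂`**: for `tsupport g ⊆ [−log 2, log 2]`,
`Re Q_{{2}}(g) = E₂(g) = 2 Re(ĝ(0) conj ĝ(1)) − (log π)‖g‖₂² + (1/2π)∫|ĝ(1/2+it)|²(Re ψ(1/4+it/2) − √2 log 2 cos(t log 2)) dt`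
— the prime `3` (visible to the FULL form on this window) is absent, the power `4` sits on the boundary.
[cite: Connes1999, §VII Thm 4 (S = {2, ∞}); Yoshida1992 §2 eq. (2.1)] -/
theorem re_weilSemilocalQuadratic_two_eq_weilFirstPrimeQuadratic (hg : IsWeilTest g)
    (hsupp : tsupport g ⊆ Icc (-Real.log 2) (Real.log 2)) :
    (weilSemilocalQuadratic {2} g).re = weilFirstPrimeQuadratic g := by
  have hsupp' : tsupport g ⊆ Icc (-(Real.log (((3 : ℕ) : ℝ) + 1) / 2)) (Real.log (((3 : ℕ) : ℝ) + 1) / 2) := by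
    rwa [log_four_half]
  rw [re_weilSemilocalQuadratic_eq_weilSemilocalAnalytic hg {2} 3 hsupp', weilSemilocalAnalytic_two_three]

/-- `Q_{{2}}(g) = E₂(g)` as complex numbers on `C(log 2)`. [cite: Connes1999, §VII Thm 4 (S = {2, ∞}); Yoshida1992 §2 eq. (2.1)] -/
theorem weilSemilocalQuadratic_two_eq_weilFirstPrimeQuadratic (hg : IsWeilTest g)
    (hsupp : tsupport g ⊆ Icc (-Real.log 2) (Real.log 2)) :
    weilSemilocalQuadratic {2} g = (weilFirstPrimeQuadratic g : ℂ) := by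
  have hsupp' : tsupport g ⊆ Icc (-(Real.log (((3 : ℕ) : ℝ) + 1) / 2)) (Real.log (((3 : ℕ) : ℝ) + 1) / 2) := by
    rwa [log_four_half]
  rw [weilSemilocalQuadratic_eq_weilSemilocalAnalytic hg {2} 3 hsupp', weilSemilocalAnalytic_two_three]

/-- **`{∞,2}`-positivity on `C(a)`, `a ≤ log 2`, is exactly `E₂ ≥ 0` on `C(a)`.** [cite: Yoshida1992, Thm 1 shape (§6) with the p = 2 term] -/
theorem weilSemilocalPositivityOn_two_iff {a : ℝ} (ha : a ≤ Real.log 2) :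
    WeilSemilocalPositivityOn {2} a ↔
      ∀ g : ℝ → ℂ, IsWeilTest g → tsupport g ⊆ Icc (-a) a → 0 ≤ weilFirstPrimeQuadratic g := by
  rw [weilSemilocalPositivityOn_iff_analytic {2} 3 (by rwa [log_four_half])]
  simp_rw [weilSemilocalAnalytic_two_three]

/-- `563/1024 ≤ log 2`. [folklore] -/
theorem certb_le_log_two : ((weilCert3C.b : ℚ) : ℝ) ≤ Real.log 2 := by
  have hb : weilCert3C.b = 563 / 1024 := by decide +kernel
  rw [hb]
  have h := Real.log_two_gt_d9
  push_cast
  linarith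

/-- **Semi-local `{∞,2}` Weil positivity on the cone `C(563/1024)`** (`563/1024 = 0.5498… > (log 3)/2 = 0.5493…`,
so this window is STRICTLY beyond the one on which the `{∞,2}` form coincides with Weil's): `Re Q_{{2}}(g) ≥ 0`
for every test function supported in `[−563/1024, 563/1024]`, by the kernel-checked Stage-C certificate
`weilCert3C` for `E₂`. [cite: Yoshida1992, Thm 1 (p. 310), §6 (method); certificate new] -/
theorem weilSemilocalPositivityOn_two_certb : WeilSemilocalPositivityOn {2} ((weilCert3C.b : ℚ) : ℝ) :=
  (weilSemilocalPositivityOn_two_iff certb_le_log_two).2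
    fun _ hg hsupp ↦ WeilCert3.weilFirstPrimeQuadratic_nonneg_of_check check_weilCert3C hg hsupp

/-- Every prime power `n ≤ 2` is a power of `2`. [folklore] -/
theorem primeFactors_subset_two_of_le_two : ∀ n ≤ 2, IsPrimePow n → n.primeFactors ⊆ ({2} : Finset ℕ) := by
  intro n hn hp
  interval_cases n
  · exact absurd hp (by decide)
  · exact absurd hp (by decide)
  · rw [Nat.prime_two.primeFactors]

/-- On `C((log 3)/2)` the `{∞,2}` form IS Weil's quadratic form (no odd prime is visible). [cite: ConnesConsani2023, §2.3 (λ² = 3: only the prime 2 enters)] -/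
theorem weilSemilocalQuadratic_two_eq_weilQuadratic (hg : IsWeilTest g)
    (hsupp : tsupport g ⊆ Icc (-(Real.log 3 / 2)) (Real.log 3 / 2)) :
    weilSemilocalQuadratic {2} g = weilQuadratic g := by
  have h3 : Real.log (((2 : ℕ) : ℝ) + 1) = Real.log 3 := by norm_num
  have hsupp' : tsupport g ⊆ Icc (-(Real.log (((2 : ℕ) : ℝ) + 1) / 2)) (Real.log (((2 : ℕ) : ℝ) + 1) / 2) := by
    rwa [h3]
  exact weilSemilocalQuadratic_eq_weilQuadratic_of_forall hg primeFactors_subset_two_of_le_two hsupp'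

/-- **`{∞,2}`-positivity on `C((log 3)/2)`** = first-prime Weil positivity (`weilPositivityOn_log_three_half`). [cite: Yoshida1992, Thm 1 (p. 310); certificate new] -/
theorem weilSemilocalPositivityOn_two_log_three_half : WeilSemilocalPositivityOn {2} (Real.log 3 / 2) := by
  have h3 : Real.log (((2 : ℕ) : ℝ) + 1) / 2 = Real.log 3 / 2 := by norm_num
  have h := (weilSemilocalPositivityOn_iff_weilPositivityOn_of_forall primeFactors_subset_two_of_le_two).2
  rw [h3] at h
  exact h weilPositivityOn_log_three_half

/-! ## `S = {2}` on `C(log 3)`: the dyadic form `E_{2,4,8}` (the 2-adic term written out exactly) -/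

/-- The dyadic weight on the `log 3`-window: `w_{2,4,8}(t) = w₂(t) − log 2 · cos(t log 4) − (log 2/√2) cos(t log 8)`
(the powers `2, 4, 8 < 9 = e^{2 log 3}` of `2`; `Λ(4)/√4 = (log 2)/2`, `Λ(8)/√8 = log 2/(2√2)`). [cite: Connes1999, §VII Thm 4 (the 2-adic term Σ_m (log 2) 2^{-m/2}(k(m log 2)+k(−m log 2)), m ≤ 3)] -/
def weilDyadicWeight (t : ℝ) : ℝ :=
  weilFirstPrimeWeight t - Real.log 2 * Real.cos (t * Real.log 4) - Real.log 2 / Real.sqrt 2 * Real.cos (t * Real.log 8)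

/-- The dyadic analytic form `E_{2,4,8}(g) = 2 Re(ĝ(0) conj ĝ(1)) − (log π)‖g‖₂² + (1/2π)∫|ĝ(1/2+it)|² w_{2,4,8}(t) dt`.
[cite: Connes1999, §VII Thm 4 (S = {2, ∞}, support ⊆ [−2 log 3, 2 log 3])] -/
def weilDyadicQuadratic (g : ℝ → ℂ) : ℝ :=
  2 * (weilMellin g 0 * conj (weilMellin g 1)).re - Real.log π * weilNorm2Sq g +
    1 / (2 * π) * ∫ t : ℝ, ‖weilMellin g (1 / 2 + t * I)‖ ^ 2 * weilDyadicWeight t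

/-- `√8 = 2√2`, so `log 2/√8 · 2 = log 2/√2`. [folklore] -/
theorem sqrt_eight : Real.sqrt (8 : ℕ) = 2 * Real.sqrt 2 := by
  rw [show ((8 : ℕ) : ℝ) = 2 ^ 2 * 2 by norm_num, Real.sqrt_mul (by norm_num), Real.sqrt_sq (by norm_num)]

/-- `w_{{2},8} = w_{2,4,8}`: on the `log 3`-window the visible powers of `2` are `2, 4, 8`. [folklore] -/
theorem weilSemilocalWeight_two_eight (t : ℝ) : weilSemilocalWeight {2} 8 t = weilDyadicWeight t := by
  have h3 := weilSemilocalWeight_two_three t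
  unfold weilSemilocalWeight at h3 ⊢
  unfold weilDyadicWeight
  rw [← h3]
  unfold weilSemilocalRipple
  rw [Finset.sum_range_succ _ 8, Finset.sum_range_succ _ 7, Finset.sum_range_succ _ 6,
    Finset.sum_range_succ _ 5, Finset.sum_range_succ _ 4]
  have h4 : weilSemilocalCoeff {2} 4 = Real.log 2 / 2 := by
    have h := weilSemilocalCoeff_two_pow (m := 2) two_ne_zero
    rw [show (2 : ℕ) ^ 2 = 4 by norm_num] at h
    rw [h, show ((4 : ℕ) : ℝ) = 2 ^ 2 by norm_num, Real.sqrt_sq (by norm_num)]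
  have h5 : weilSemilocalCoeff {2} 5 = 0 := weilSemilocalCoeff_two_prime Nat.prime_five (by norm_num)
  have h6 : weilSemilocalCoeff {2} 6 = 0 := weilSemilocalCoeff_of_not_isPrimePow _ (by decide)
  have h7 : weilSemilocalCoeff {2} 7 = 0 := weilSemilocalCoeff_two_prime (by norm_num : Nat.Prime 7) (by norm_num)
  have h8 : weilSemilocalCoeff {2} 8 = Real.log 2 / (2 * Real.sqrt 2) := by
    have h := weilSemilocalCoeff_two_pow (m := 3) (by norm_num)
    rw [show (2 : ℕ) ^ 3 = 8 by norm_num] at h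
    rw [h, sqrt_eight]
  rw [h4, h5, h6, h7, h8, show ((4 : ℕ) : ℝ) = 4 by norm_num, show ((8 : ℕ) : ℝ) = 8 by norm_num]
  have hs : Real.sqrt 2 ≠ 0 := (Real.sqrt_pos.2 (by norm_num : (0 : ℝ) < 2)).ne'
  field_simp
  ring

/-- **`E_{{2},8} = E_{2,4,8}`** (for every `g`). [folklore] -/
theorem weilSemilocalAnalytic_two_eight (g : ℝ → ℂ) : weilSemilocalAnalytic {2} 8 g = weilDyadicQuadratic g := by
  unfold weilSemilocalAnalytic weilDyadicQuadratic
  simp_rw [weilSemilocalWeight_two_eight]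

/-- `log 9 / 2 = log 3`. [folklore] -/
theorem log_nine_half : Real.log ((8 : ℕ) + 1 : ℝ) / 2 = Real.log 3 := by
  rw [show ((8 : ℕ) : ℝ) + 1 = 3 ^ 2 by norm_num, Real.log_pow]
  push_cast
  ring

/-- **The `{∞,2}` semi-local form on `C(log 3)` written out exactly**: for `tsupport g ⊆ [−log 3, log 3]`,
`Re Q_{{2}}(g) = E_{2,4,8}(g)` — the primes `3, 5, 7` (visible to the FULL form there) are absent, the powers
`2, 4, 8` of `2` carry the weights `log 2/√2, (log 2)/2, log 2/(2√2)`. [cite: Connes1999, §VII Thm 4 (S = {2, ∞}); Yoshida1992 §2 eq. (2.1)] -/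
theorem re_weilSemilocalQuadratic_two_eq_weilDyadicQuadratic (hg : IsWeilTest g)
    (hsupp : tsupport g ⊆ Icc (-Real.log 3) (Real.log 3)) :
    (weilSemilocalQuadratic {2} g).re = weilDyadicQuadratic g := by
  have hsupp' : tsupport g ⊆ Icc (-(Real.log (((8 : ℕ) : ℝ) + 1) / 2)) (Real.log (((8 : ℕ) : ℝ) + 1) / 2) := by
    rwa [log_nine_half]
  rw [re_weilSemilocalQuadratic_eq_weilSemilocalAnalytic hg {2} 8 hsupp', weilSemilocalAnalytic_two_eight]

/-- **`{∞,2}`-positivity on `C(a)`, `a ≤ log 3`, is exactly `E_{2,4,8} ≥ 0` on `C(a)`.** [cite: Yoshida1992, Thm 1 shape (§6) with the p^m = 2, 4, 8 terms] -/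
theorem weilSemilocalPositivityOn_two_iff_dyadic {a : ℝ} (ha : a ≤ Real.log 3) :
    WeilSemilocalPositivityOn {2} a ↔
      ∀ g : ℝ → ℂ, IsWeilTest g → tsupport g ⊆ Icc (-a) a → 0 ≤ weilDyadicQuadratic g := by
  rw [weilSemilocalPositivityOn_iff_analytic {2} 8 (by rwa [log_nine_half])]
  simp_rw [weilSemilocalAnalytic_two_eight]

/-- The dyadic form extends `E₂`: on `C(log 2)` they agree. [folklore] -/
theorem weilDyadicQuadratic_eq_weilFirstPrimeQuadratic (hg : IsWeilTest g)
    (hsupp : tsupport g ⊆ Icc (-Real.log 2) (Real.log 2)) :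
    weilDyadicQuadratic g = weilFirstPrimeQuadratic g := by
  have h23 : Real.log 2 ≤ Real.log 3 := Real.log_le_log (by norm_num) (by norm_num)
  rw [← re_weilSemilocalQuadratic_two_eq_weilDyadicQuadratic hg (hsupp.trans (Icc_subset_Icc (by linarith) h23)),
    re_weilSemilocalQuadratic_two_eq_weilFirstPrimeQuadratic hg hsupp]

end Literature.NumberTheory.LFunctions
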